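import Literature.NumberTheory.Transcendental.NewPointsScaled
import Literature.NumberTheory.Transcendental.AuxiliaryFunctionSpaced
import Literature.NumberTheory.Transcendental.ExtrapolationSpaced
import Literature.NumberTheory.Transcendental.TorsionOrbit
import HarnessLib

/-!
# Baker's method on `M_κ`, torsion case: vanishing at the new points and the engine

Topic: `Literature/NumberTheory/Transcendental`. Plan item W4 (closing, torsion case, part 4)
of the unit `provefact-Literature.NumberTheory.Transcendental.H-b596640137`. The torsion-case
engine of Baker–Wüstholz's proof of the Semistability Theorem (*Logarithmic Forms and
Diophantine Geometry*, §6.8, pp. 117–119) for a Baker datum whose point `v` is the division point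
`u/ℓ` of a point `u = ℓ·v` with `exp(u)` of finite order dividing `S_rows + 1`
(`(ℓ(S_rows+1))·v ∈ ker`):

* the auxiliary form is constructed with Siegel rows at the `S_rows + 1` points `(ℓ s₀)·v = s₀·u`
  only (`AuxiliaryFunctionSpaced.exists_auxiliary₃`, `(S_rows+1)·T^{dd}` conditions);
* by the `ker`-periodicity of the order of vanishing (`TorsionOrbit.vanishesAlong_all_multiples`)
  it then vanishes to order `≥ T` along `𝔟` at `(ℓ j)·v` for EVERY `j ∈ ℕ`;
* the extrapolation with zeros at `ℓ j`, `j ≤ S₀` (`S₀` a free parameter,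
  `ExtrapolationSpaced.norm_extrapFun_grid_le₃`), the Liouville step and the grid lemma
  (`PointStep.vanishesAlong_of_small`) give the vanishing to order `≥ T'` at ALL the multiples
  `s·v`, `s ≤ S₁`, under the numerical condition `NumCond₃` (the scaled condition `NumCond₂` of
  `NewPointsScaled.lean` with the saving factor `(2(s + ℓS₀)/R)^{(T-k)(S₀+1)}`).

PROVED: `BakerData.NumCond₃` (definition), `BakerData.vanishesAlong_newPoints₃`,
`BakerData.engine₃`.

## References

* A. Baker, G. Wüstholz, *Logarithmic Forms and Diophantine Geometry*, CUP 2007, §6.8 (pp. 117–119).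
-/

noncomputable section

open Complex MvPolynomial Finset NumberField
open scoped PeriodPair

namespace Literature.NumberTheory.Transcendental

namespace GaGmE

namespace Std

namespace BakerData

variable {β γ δ : Type} [Fintype β] [Fintype γ] [Fintype δ] [DecidableEq γ]
variable [DecidableEq β] [DecidableEq δ] (B : BakerData β γ δ)

/-- **The numerical condition of the torsion case**: for all `s ≤ S₁`, `k < T'`,
`k!·(kX+1)^k·#U·H_ξ·e^{C_Θ(1+(R‖v‖+1)²)·D}·(2(s+ℓS₀)/R)^{(T-k)(S₀+1)} · |d_s|^E (|d_s|^E Λ_{s,k})^{h-1}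
  < (c_Θ e^{-C'_Θ(1+s²)})^{D}` (`D = nD'`): `NewPointsScaled.NumCond₂` with the saving factor of the
spaced zeros `ℓ j`, `j ≤ S₀`. [folklore] -/
def NumCond₃ {D' : ℕ} (ξ : UIdx β γ δ D' → 𝓞 B.K) (ℓ T S₀ S₁ T' : ℕ) (R : ℝ) : Prop :=
  ∀ s : ℕ, s ≤ S₁ → ∀ k : ℕ, k < T' →
    (k.factorial : ℝ) * ((k : ℝ) * B.dirNorm + 1) ^ k * (Fintype.card (UIdx β γ δ D') * B.houseXi ξ *
        Real.exp (thetaGrowthC (β := β) B.L B.κM * (1 + (R * ‖B.v‖ + 1) ^ 2)) ^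
          (Fintype.card (β ⊕ (γ ⊕ δ)) * D')) *
      (2 * ((s : ℝ) + ℓ * S₀) / R) ^ ((T - k) * (S₀ + 1)) *
      (|(B.dAt s : ℝ)| ^ B.expE (Fintype.card (β ⊕ (γ ⊕ δ)) * D') k *
        (|(B.dAt s : ℝ)| ^ B.expE (Fintype.card (β ⊕ (γ ⊕ δ)) * D') k * B.lineValBound ξ s k) ^
          (B.gens.h - 1)) <
    (B.thetaLowc * Real.exp (-(B.thetaLowC * (1 + (s : ℝ) ^ 2)))) ^ (Fintype.card (β ⊕ (γ ⊕ δ)) * D')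

/-- **Vanishing at the new points (torsion case).** If `v ∈ 𝔟`, the auxiliary form vanishes to
order `≥ T` along `𝔟` at the spaced multiples `(ℓ j)·v`, `j ≤ S₀` (`ℓ ≥ 1`), `R ≥ 2(S₁ + ℓS₀) > 0`
and `NumCond₃` holds, then it vanishes to order `≥ T'` along `𝔟` at `s·v` for every `s ≤ S₁`.
[cite: BakerWustholz2007, §6.8 (p. 119: "We conclude that Ψ(s) = 0 … for all integers s = 0, …, ℓS")] -/
theorem vanishesAlong_newPoints₃ (hv : B.v ∈ B.bSpan) {D' : ℕ} (ξ : UIdx β γ δ D' → 𝓞 B.K)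
    {ℓ T S₀ S₁ T' : ℕ} {R : ℝ} (hℓ : 0 < ℓ) (hR0 : 0 < R) (hR : 2 * ((S₁ : ℝ) + ℓ * S₀) ≤ R)
    (hvan : ∀ j : ℕ, j ≤ S₀ →
      VanishesAlong B.bSpan (thetaEval B.L B.κM (B.auxForm ξ)) (((ℓ * j : ℕ) : ℂ) • B.v) T)
    (hnum : B.NumCond₃ ξ ℓ T S₀ S₁ T' R) {s : ℕ} (hs : s ≤ S₁) :
    VanishesAlong B.bSpan (thetaEval B.L B.κM (B.auxForm ξ)) ((s : ℂ) • B.v) T' := by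
  obtain ⟨hC0, hC⟩ := thetaGrowthC_spec (β := β) B.L B.κM
  obtain ⟨hc0, hC'0, hlow⟩ := B.thetaLow_spec
  refine B.vanishesAlong_of_small ξ s T' fun k hk cg hcg => ?_
  have hRs : 2 * ((s : ℝ) + ℓ * S₀) ≤ R := by
    have : (s : ℝ) ≤ S₁ := by exact_mod_cast hs
    linarith
  have hφ := B.norm_extrapFun_grid_le₃ hC0 hC hv ξ hℓ hvan hcg s hR0 hRs
  have hΛ : 0 ≤ |(B.dAt s : ℝ)| ^ B.expE (Fintype.card (β ⊕ (γ ⊕ δ)) * D') k *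
      (|(B.dAt s : ℝ)| ^ B.expE (Fintype.card (β ⊕ (γ ⊕ δ)) * D') k * B.lineValBound ξ s k) ^ (B.gens.h - 1) := by
    have := B.lineValBound_nonneg ξ s k
    positivity
  have hΘ : (B.thetaLowc * Real.exp (-(B.thetaLowC * (1 + (s : ℝ) ^ 2)))) ^ (Fintype.card (β ⊕ (γ ⊕ δ)) * D') ≤
      ‖theta B.L B.κM (baseIdx (B.cAt s)) ((s : ℂ) • B.v)‖ ^ (Fintype.card (β ⊕ (γ ⊕ δ)) * D') :=
    pow_le_pow_left₀ (by positivity) (hlow s) _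
  calc ‖extrapFun B.L B.κM (B.auxForm ξ) B.v (B.gridDir cg) k s‖ *
        (|(B.dAt s : ℝ)| ^ B.expE (Fintype.card (β ⊕ (γ ⊕ δ)) * D') k *
          (|(B.dAt s : ℝ)| ^ B.expE (Fintype.card (β ⊕ (γ ⊕ δ)) * D') k * B.lineValBound ξ s k) ^ (B.gens.h - 1))
      ≤ _ := mul_le_mul_of_nonneg_right hφ hΛ
    _ < _ := hnum s hs k hk
    _ ≤ _ := hΘ

omit [DecidableEq β] [DecidableEq δ] in
/-- `(ℓ j)·v = j·(ℓ·v)`. [folklore] -/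
theorem mul_smul_eq (ℓ j : ℕ) : ((ℓ * j : ℕ) : ℂ) • B.v = (j : ℂ) • ((ℓ : ℂ) • B.v) := by
  rw [smul_smul, Nat.cast_mul, mul_comm]

/-- **The Baker engine of the torsion case.** Let `v ∈ 𝔟` with `(ℓ(S_rows+1))·v ∈ ker` (`ℓ ≥ 1`),
`T ≥ 1`, `(S_rows+1)·T^{dd} < (D'+1)^n` (Siegel feasibility with the rows at `(ℓ s₀)·v`,
`s₀ ≤ S_rows` only), `R > 0`, `R ≥ 2(S₁ + ℓS₀)`, and suppose `NumCond₃` holds for every coefficient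
vector within the Siegel house bound `siegelHouseBound₃`. Then there is a form `P`, homogeneous of
degree `nD'`, with `F_P ≢ 0` and `F_P` vanishing to order `≥ T'` along `𝔟` at `s·v` for all
`s ≤ S₁`. [cite: BakerWustholz2007, §6.8 (pp. 117–119)] -/
theorem engine₃ (hv : B.v ∈ B.bSpan) (ℓ D' T Srows S₀ S₁ T' : ℕ) (R : ℝ) (hℓ : 0 < ℓ) (hT : 0 < T)
    (hpq : (Srows + 1) * T ^ B.dd < (D' + 1) ^ Fintype.card (β ⊕ (γ ⊕ δ)))
    (hper : ((ℓ * (Srows + 1) : ℕ) : ℂ) • B.v ∈ ker B.L B.κM)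
    (hR0 : 0 < R) (hR : 2 * ((S₁ : ℝ) + ℓ * S₀) ≤ R)
    (hnum : ∀ ξ : UIdx β γ δ D' → 𝓞 B.K,
      (∀ u, house ((ξ u : 𝓞 B.K) : B.K) ≤ B.siegelHouseBound₃ ℓ D' T Srows) →
        B.NumCond₃ ξ ℓ T S₀ S₁ T' R) :
    ∃ P : MvPolynomial (Option β × ThetaIdx γ δ) ℂ,
      P.IsHomogeneous (Fintype.card (β ⊕ (γ ⊕ δ)) * D') ∧
      (∃ w, thetaEval B.L B.κM P w ≠ 0) ∧
      ∀ s : ℕ, s ≤ S₁ → VanishesAlong B.bSpan (thetaEval B.L B.κM P) ((s : ℂ) • B.v) T' := by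
  obtain ⟨ξ, -, hhouse, hne, hvan⟩ := B.exists_auxiliary₃ ℓ D' T Srows hT hpq
  refine ⟨B.auxForm ξ, isHomogeneous_homog _ _, hne, fun s hs => ?_⟩
  -- vanishing at ALL the spaced multiples `(ℓ j)·v` by `ker`-periodicity
  have hall : ∀ j : ℕ, VanishesAlong B.bSpan (thetaEval B.L B.κM (B.auxForm ξ)) (((ℓ * j : ℕ) : ℂ) • B.v) T := by
    intro j
    rw [B.mul_smul_eq]
    refine vanishesAlong_all_multiples B.L B.κM (isHomogeneous_homog _ (B.QOf ξ)) B.bSpan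
      (u := (ℓ : ℂ) • B.v) (P₁ := Srows + 1) (Nat.succ_pos _) ?_ (fun s₀ hs₀ => ?_) j
    · rw [← B.mul_smul_eq]; exact hper
    · rw [← B.mul_smul_eq]; exact hvan s₀ (Nat.lt_succ_iff.mp hs₀)
  exact B.vanishesAlong_newPoints₃ hv ξ hℓ hR0 hR (fun j _ => hall j) (hnum ξ hhouse) hs

end BakerData

end Std

end GaGmE

end Literature.NumberTheory.Transcendental

end
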